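import Summits.HodgeConjecture.HodgeConjecture.Theorems.Q8CommutatorDegreeTwoCore

/-!
# Rung `Q8CommutatorDegreeTwoCore`, CAYLEY form: the degree-2 quaternionic-centraliser invariant statement from
# invariance under commutators of CAYLEY-PARAMETRISABLE centraliser elements only (`det(1 + g) ≠ 0`)

Cell `hodge-nonav`, prover seat `hodge-nonav-20241-p1` (g20); programme K2Q (crux `PowersHodgeOfQuaternionCommutators`,
stmt-HodgeConjecture-24191, route `Q8SymplecticPowers`), brick ENGINE-CAYLEY (planner answer P3 g36 2026-08-29T07:54:56Z:
«yours», option (a): a sibling file; `Q8CommutatorDegreeTwoCore` ∕ `Q8SymplecticPowersStubDegreeTwoCore` untouched).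
HELPER FILE (`--supports stmt-HodgeConjecture-24191 --as helper`). Sorry-free; axioms standard.

WHY. The crux's hypothesis `Comm` delivers invariance under commutators of RATIONAL points of the quaternionic centraliser
only; the Cayley ascent (brick ASC-Q; route A's `CyclicUnitaryPowersCommutatorAscent.commutator_invariance_ascends` ∕
`CyclicUnitaryPowersDeckUnitaryCayleyAscent.tensorSpaceActOver_commutator_eq`) lifts this to commutators `[g, h]` of
`K`-points `g, h` with `det(1 + g)`, `det(1 + h)` INVERTIBLE — the Cayley-parametrised cell — and not to all `K`-points
(the same phenomenon as the planner's PARITY lemma: `ℚ`-points of a `D`-linear group have even rank defect, Cayley points avoid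
the eigenvalue `−1`). This file proves the rung `q8Commutator_invariant_bilinForm_eq` (p705032) under that WEAKER hypothesis.

HOW. The proof of p705032 uses the hypothesis only through step (0) «`c` is invariant under every quaternionic
transvection `T_{v,l} : x ↦ x + l·Q(x, bv)v − l·Q(x, v)bv`, `v ∈ M = ker(a − i)`», obtained from
`exists_q8Centraliser_commutator_eq_qtransvection`: `T_{v,l} = [D, T_{v,l/3}]` with `D` the hyperbolic `D`-dilation of
ratio `2` (`(α, β) = (1, ½)`). Both are Cayley-parametrisable: `1 + D = 2·D_{(½,¼)}` and `1 + T_{v,s} = 2·T_{v,s/2}` are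
invertible (inverses `D_{(−⅓,−⅓)}`, `T_{v,−s/2}` by `qdilation_comp`, `qtransvection_comp`), so their determinants are units
(`exists_q8Centraliser_cayley_commutator_eq_qtransvection`); steps (A)–(D) of p705032 are then repeated VERBATIM.

* `exists_q8Centraliser_cayley_commutator_eq_qtransvection` — the commutator presentation of `T_{v,l}` with the two
  determinant clauses;
* `q8Commutator_invariant_bilinForm_eq_of_cayley` — the rung with `hc` restricted to Cayley-parametrisable `g, h`
  (binders otherwise verbatim; `V` finite-dimensional so that `LinearMap.det` is meaningful).

Honest scope: linear algebra; nothing here says HC, HC_CM or HC_AV is proved.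

References: R. Goodman, N. Wallach, *Symmetry, Representations, and Invariants* (GTM 255), §2.2.3 Exercise 1 (Cayley
parameters), §1.4.5; planner memo ROUTE-P3v26/v27 (route `Q8SymplecticPowers`). hodge-nonav 20241-p1 g20, 2026-08-29.
-/

set_option linter.dupNamespace false

namespace Summit.HodgeConjecture.HodgeConjecture.Theorems.Q8CommutatorDegreeTwoCoreCayley

open LinearMap
open Summit.HodgeConjecture.HodgeConjecture.Theorems.Q8CommutatorDegreeTwoCoreTransvections
open Summit.HodgeConjecture.HodgeConjecture.Theorems.Q8CommutatorDegreeTwoCore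

variable {K V : Type*} [Field K] [AddCommGroup V] [Module K V] {Q : LinearMap.BilinForm K V}

/-- An endomorphism with a two-sided inverse has unit determinant. [folklore] -/
private theorem isUnit_det_of_mul_eq_one [FiniteDimensional K V] {f g : V →ₗ[K] V} (h₁ : f * g = 1) (h₂ : g * f = 1) :
    IsUnit (LinearMap.det f) := by
  have hu : IsUnit f := ⟨⟨f, g, h₁, h₂⟩, rfl⟩
  exact hu.map LinearMap.det

/-- `1 + (2 • u)`-type rescaling: if `f + 1 = (2 : K) • u` with `u` invertible then `det (f + 1)` is a unit (char 0).
[folklore] -/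
private theorem isUnit_det_add_one_of_eq_two_smul [CharZero K] [FiniteDimensional K V] {f u u' : V →ₗ[K] V}
    (hf : f + 1 = (2 : K) • u) (h₁ : u * u' = 1) (h₂ : u' * u = 1) : IsUnit (LinearMap.det (f + 1)) := by
  rw [hf, LinearMap.det_smul]
  exact (IsUnit.pow _ (isUnit_iff_ne_zero.2 two_ne_zero)).mul (isUnit_det_of_mul_eq_one h₁ h₂)

/-- **The quaternionic transvection `T_{v,l}` is the commutator of two CAYLEY-PARAMETRISABLE elements of the quaternionic
centraliser**: `T_{v,l} = [D, T_{v,l/3}]` with `D` the hyperbolic `D`-dilation of ratio `2` and `T_{v,l/3}` a transvection, both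
commuting with `a, b`, both `Q`-isometries, and BOTH with `det(1 + ·)` a unit (`1 + D = 2·D_{(½,¼)}`, `1 + T_{v,s} = 2·T_{v,s/2}`).
[cite: GoodmanWallachGTM255, §2.2.3 Exercise 1] -/
theorem exists_q8Centraliser_cayley_commutator_eq_qtransvection [CharZero K] [FiniteDimensional K V]
    (hQs : ∀ x y, Q x y = Q y x) (hQn : Q.Nondegenerate)
    (a b : V →ₗ[K] V) (haa : ∀ x, a (a x) = -x) (hbb : ∀ x, b (b x) = -x)
    (hab : ∀ x, a (b x) = -b (a x))
    (haQ : ∀ x y, Q (a x) (a y) = Q x y) (hQb : ∀ x y, Q (b x) (b y) = Q x y)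
    {i : K} (hi : i * i = -1) {v : V} (hv : a v = i • v) (l : K) :
    ∃ g h : V ≃ₗ[K] V,
      ((∀ x, g (a x) = a (g x)) ∧ (∀ x, g (b x) = b (g x)) ∧ ∀ x y, Q (g x) (g y) = Q x y) ∧
      ((∀ x, h (a x) = a (h x)) ∧ (∀ x, h (b x) = b (h x)) ∧ ∀ x y, Q (h x) (h y) = Q x y) ∧
      IsUnit (LinearMap.det ((g : V →ₗ[K] V) + 1)) ∧ IsUnit (LinearMap.det ((h : V →ₗ[K] V) + 1)) ∧
      ∀ x, (g * h * g⁻¹ * h⁻¹) x = x + (l * Q x (b v)) • v + (-(l * Q x v)) • b v := by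
  have hdet1 : IsUnit (LinearMap.det ((1 : V →ₗ[K] V) + 1)) := by
    have h2 : (1 : V →ₗ[K] V) + 1 = (2 : K) • (1 : V →ₗ[K] V) := by rw [two_smul]
    exact isUnit_det_add_one_of_eq_two_smul h2 (mul_one 1) (mul_one 1)
  rcases eq_or_ne v 0 with rfl | hv0
  · refine ⟨1, 1, ⟨fun x => rfl, fun x => rfl, fun x y => rfl⟩,
      ⟨fun x => rfl, fun x => rfl, fun x y => rfl⟩, ?_, ?_, fun x => by simp⟩
    · exact hdet1
    · exact hdet1
  obtain ⟨w, hw, hvw⟩ := exists_hyperbolic_partner hQs hQn haa hbb hab haQ hi hv0 hv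
  obtain ⟨D, hD⟩ := exists_qdilation_equiv hQs haQ hbb hQb hi hv hw hvw
  obtain ⟨T, hT⟩ := exists_qtransvection_equiv hQs haQ hbb hQb hi hv (l / 3)
  -- the explicit linear maps `D_{(α,β)}` and `T_{v,s}`
  let Dl : K → K → (V →ₗ[K] V) := fun α β ↦
    LinearMap.id + (α • Q.flip (b w)).smulRight v + (β • Q.flip (b v)).smulRight w +
      ((-α) • Q.flip w).smulRight (b v) + ((-β) • Q.flip v).smulRight (b w)
  have hDl : ∀ (α β : K) (x : V), Dl α β x =
      x + (α * Q x (b w)) • v + (β * Q x (b v)) • w + (-(α * Q x w)) • b v + (-(β * Q x v)) • b w := by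
    intro α β x
    simp [Dl]
  let Tl : K → (V →ₗ[K] V) := fun s ↦
    LinearMap.id + (s • Q.flip (b v)).smulRight v + ((-s) • Q.flip v).smulRight (b v)
  have hTl : ∀ (s : K) (x : V), Tl s x = x + (s * Q x (b v)) • v + (-(s * Q x v)) • b v := by
    intro s x
    simp [Tl]
  -- `1 + D = 2 • D_{(1/2,1/4)}`, invertible
  have hD1 : (D : V →ₗ[K] V) + 1 = (2 : K) • Dl (1 / 2) (1 / 4) := by
    ext x
    rw [LinearMap.add_apply, LinearMap.smul_apply, hDl, LinearEquiv.coe_coe, hD x, Module.End.one_apply]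
    module
  have hDinv₁ : Dl (1 / 2) (1 / 4) * Dl (-(1 / 3)) (-(1 / 3)) = 1 := by
    ext x
    rw [Module.End.mul_apply, Module.End.one_apply]
    exact qdilation_comp hQs haQ hbb hQb hi hv hw hvw (by norm_num) (by norm_num) (hDl _ _) (hDl _ _) x
  have hDinv₂ : Dl (-(1 / 3)) (-(1 / 3)) * Dl (1 / 2) (1 / 4) = 1 := by
    ext x
    rw [Module.End.mul_apply, Module.End.one_apply]
    exact qdilation_comp hQs haQ hbb hQb hi hv hw hvw (by norm_num) (by norm_num) (hDl _ _) (hDl _ _) x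
  -- `1 + T_{v,l/3} = 2 • T_{v,l/6}`, invertible
  have hT1 : (T : V →ₗ[K] V) + 1 = (2 : K) • Tl (l / 6) := by
    ext x
    rw [LinearMap.add_apply, LinearMap.smul_apply, hTl, LinearEquiv.coe_coe, hT x, Module.End.one_apply]
    module
  have hTinv₁ : Tl (l / 6) * Tl (-(l / 6)) = 1 := by
    ext x
    rw [Module.End.mul_apply, Module.End.one_apply,
      qtransvection_comp hQs haQ hbb hQb hi hv (hTl (l / 6)) (hTl (-(l / 6))) x]
    simp
  have hTinv₂ : Tl (-(l / 6)) * Tl (l / 6) = 1 := by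
    ext x
    rw [Module.End.mul_apply, Module.End.one_apply,
      qtransvection_comp hQs haQ hbb hQb hi hv (hTl (-(l / 6))) (hTl (l / 6)) x]
    simp
  refine ⟨D, T,
    ⟨fun x => qdilation_comm_a haQ hi hv hw hab hD x,
      fun x => qdilation_comm_b hQs hbb hQb hD x,
      fun x y => qdilation_isometry hQs haQ hbb hQb hi hv hw hvw (by norm_num) hD x y⟩,
    ⟨fun x => qtransvection_comm_a haQ hi hv hab hT x, fun x => qtransvection_comm_b hQs hbb hQb hT x,
      fun x y => qtransvection_isometry hQs haQ hbb hQb hi hv hT x y⟩,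
    isUnit_det_add_one_of_eq_two_smul hD1 hDinv₁ hDinv₂,
    isUnit_det_add_one_of_eq_two_smul hT1 hTinv₁ hTinv₂, ?_⟩
  obtain ⟨t1, t2, t3, t4⟩ := table_v hQs haQ hbb hQb hi hv
  refine SignCommutatorDegreeTwoCore.commutator_apply_of fun y => ?_
  show D (T y) = T (D y) + (l * Q (T (D y)) (b v)) • v + (-(l * Q (T (D y)) v)) • b v
  rw [qdilation_qtransvection hQs haQ hbb hQb hi hv hw hvw (l'' := l + l / 3) (by ring) hD hT,
    hT (D y)]
  simp only [map_add, map_smul, LinearMap.add_apply, LinearMap.smul_apply, smul_eq_mul,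
    t1, t2, t3, t4, mul_zero]
  module

/-- **Rung `Q8CommutatorDegreeTwoCore`, Cayley form**: over a field of characteristic zero containing `i` with `i * i = -1`, on a
finite-dimensional `V` with a symmetric nondegenerate `Q` and a quaternionic pair `a, b` of `Q`-isometries (`a² = b² = −1`,
`ab = −ba`), a bilinear form invariant under the commutators `[g, h]` of those `Q`-isometries `g, h` commuting with `a, b`
WHOSE `det(1 + g)`, `det(1 + h)` ARE UNITS is `x y ↦ Q x (d y)` for some `d = α + β a + γ b + δ a b`. Proof = p705032's, step (0)
fed by `exists_q8Centraliser_cayley_commutator_eq_qtransvection`. [cite: GoodmanWallachGTM255, §2.2.3 Exercise 1] -/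
theorem q8Commutator_invariant_bilinForm_eq_of_cayley [CharZero K] [FiniteDimensional K V]
    (hQs : ∀ x y, Q x y = Q y x) (hQn : Q.Nondegenerate)
    (a b : V →ₗ[K] V) (haa : ∀ x, a (a x) = -x) (hbb : ∀ x, b (b x) = -x)
    (hab : ∀ x, a (b x) = -b (a x))
    (haQ : ∀ x y, Q (a x) (a y) = Q x y) (hQb : ∀ x y, Q (b x) (b y) = Q x y)
    {i : K} (hi : i * i = -1) (c : LinearMap.BilinForm K V)
    (hc : ∀ g h : V ≃ₗ[K] V, (∀ x, g (a x) = a (g x)) → (∀ x, g (b x) = b (g x)) →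
      (∀ x y, Q (g x) (g y) = Q x y) → (∀ x, h (a x) = a (h x)) → (∀ x, h (b x) = b (h x)) →
      (∀ x y, Q (h x) (h y) = Q x y) →
      IsUnit (LinearMap.det ((g : V →ₗ[K] V) + 1)) → IsUnit (LinearMap.det ((h : V →ₗ[K] V) + 1)) →
      ∀ x y, c ((g * h * g⁻¹ * h⁻¹) x) ((g * h * g⁻¹ * h⁻¹) y) = c x y) :
    ∃ α β γ δ : K, ∀ x y,
      c x y = α * Q x y + β * Q x (a y) + γ * Q x (b y) + δ * Q x (a (b y)) := by
  -- (0) invariance of `c` under every quaternionic transvection along `v ∈ M`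
  have hT : ∀ {v : V}, a v = i • v → ∀ (l : K) (x y : V),
      c (x + (l * Q x (b v)) • v + (-(l * Q x v)) • b v)
        (y + (l * Q y (b v)) • v + (-(l * Q y v)) • b v) = c x y := by
    intro v hv l x y
    obtain ⟨g, h, ⟨hg1, hg2, hg3⟩, ⟨hh1, hh2, hh3⟩, hg4, hh4, hgh⟩ :=
      exists_q8Centraliser_cayley_commutator_eq_qtransvection hQs hQn a b haa hbb hab haQ hQb hi hv l
    have := hc g h hg1 hg2 hg3 hh1 hh2 hh3 hg4 hh4 x y
    rwa [hgh x, hgh y] at this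
  have expand : ∀ (l : K) (v x y : V),
      c (x + (l * Q x (b v)) • v + (-(l * Q x v)) • b v)
        (y + (l * Q y (b v)) • v + (-(l * Q y v)) • b v) =
      c x y + l * (Q y (b v) * c x v - Q y v * c x (b v) + Q x (b v) * c v y - Q x v * c (b v) y)
        + l * l * (Q x (b v) * Q y (b v) * c v v - Q x (b v) * Q y v * c v (b v)
          - Q x v * Q y (b v) * c (b v) v + Q x v * Q y v * c (b v) (b v)) := by
    intro l v x y
    simp only [map_add, map_smul, LinearMap.add_apply, LinearMap.smul_apply, smul_eq_mul]
    ring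
  -- (A) the basic identity from invariance under `T_{v,1}` and `T_{v,-1}`
  have hA : ∀ {v : V}, a v = i • v → ∀ x y,
      Q y (b v) * c x v - Q y v * c x (b v) + Q x (b v) * c v y - Q x v * c (b v) y = 0 := by
    intro v hv x y
    have h1 := hT hv 1 x y
    have h2 := hT hv (-1) x y
    rw [expand] at h1 h2
    linear_combination (1 / 2 : K) * h1 - (1 / 2 : K) * h2
  -- shorthand facts
  have iso : ∀ {x u : V}, a x = i • x → a u = i • u → Q x u = 0 := fun hx hu =>
    eigen_isotropic haQ hi hx hu
  have bl : ∀ x y, Q (b x) y = -Q x (b y) := b_left hQs hbb hQb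
  -- (B) the four block identities, over `M = eigenspace a i`
  set M := Module.End.eigenspace a i with hM
  have memM : ∀ {x : V}, x ∈ M ↔ a x = i • x := fun {x} => by
    rw [hM, Module.End.mem_eigenspace_iff]
  have hmem : ∀ x : M, a (x : V) = i • (x : V) := fun x => memM.mp x.2
  set S := M.subtype with hS
  set ωM : LinearMap.BilinForm K M := (Q.compl₂ b).compl₁₂ S S with hωM
  have ωM_apply : ∀ x u : M, ωM x u = Q (x : V) (b (u : V)) := fun x u => rfl
  -- right non-degeneracy of `ωM`
  have hωr : ∀ u : M, (∀ x : M, ωM x u = 0) → u = 0 := by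
    intro u hu
    have hbu : a (b (u : V)) = (-i) • b (u : V) := b_eigen hab (hmem u)
    have hmi : (-i) * (-i) = -1 := by linear_combination hi
    have key : ∀ z : V, Q z (b (u : V)) = 0 := by
      intro z
      have hz1 : a (z - i • a z) = i • (z - i • a z) := by
        simp only [map_sub, map_smul, haa, smul_neg]
        linear_combination (norm := module) hi • a z
      have hz2 : a (z + i • a z) = (-i) • (z + i • a z) := by
        simp only [map_add, map_smul, haa, smul_neg]
        linear_combination (norm := module) hi • a z
      have e1 : Q (z - i • a z) (b (u : V)) = 0 := by
        have := hu ⟨z - i • a z, memM.mpr hz1⟩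
        rwa [ωM_apply] at this
      have e2 : Q (z + i • a z) (b (u : V)) = 0 := eigen_isotropic haQ hmi hz2 hbu
      have e3 : (2 : K) * Q z (b (u : V)) = 0 := by
        have := congrArg₂ (· + ·) e1 e2
        simp only [map_sub, map_add, map_smul, LinearMap.sub_apply, LinearMap.add_apply,
          LinearMap.smul_apply, smul_eq_mul, add_zero] at this
        linear_combination this
      simpa using e3
    have hbu0 : b (u : V) = 0 := hQn.2 _ key
    have hu0 : (u : V) = 0 := by
      have := hbb (u : V)
      rw [hbu0, map_zero] at this
      exact neg_eq_zero.mp this.symm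
    exact Subtype.ext hu0
  -- the four transported block forms on `M`
  obtain ⟨μ₁, hμ₁⟩ := multiplier_of_identity ωM hωr (c.compl₁₂ S S) (fun u x y => by
    simp only [ωM_apply, LinearMap.compl₁₂_apply, hS, Submodule.subtype_apply]
    have h := hA (hmem u) (x : V) (y : V)
    rw [iso (hmem y) (hmem u), iso (hmem x) (hmem u)] at h
    linear_combination h)
  obtain ⟨μ₂, hμ₂⟩ := multiplier_of_identity ωM hωr ((c.compl₂ b).compl₁₂ S S) (fun u x y => by
    simp only [ωM_apply, LinearMap.compl₁₂_apply, LinearMap.compl₂_apply, hS,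
      Submodule.subtype_apply]
    have h := hA (hmem u) (x : V) (b (y : V))
    rw [hQb, iso (hmem y) (hmem u), bl (y : V) (u : V), iso (hmem x) (hmem u)] at h
    linear_combination h)
  obtain ⟨μ₃, hμ₃⟩ := multiplier_of_identity ωM hωr ((c ∘ₗ b).compl₁₂ S S) (fun u x y => by
    simp only [ωM_apply, LinearMap.compl₁₂_apply, LinearMap.comp_apply, hS,
      Submodule.subtype_apply]
    have h := hA (hmem u) (b (x : V)) (y : V)
    rw [hQb, iso (hmem y) (hmem u), iso (hmem x) (hmem u), bl (x : V) (u : V)] at h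
    linear_combination h)
  obtain ⟨μ₄, hμ₄⟩ := multiplier_of_identity ωM hωr (((c ∘ₗ b).compl₂ b).compl₁₂ S S)
    (fun u x y => by
    simp only [ωM_apply, LinearMap.compl₁₂_apply, LinearMap.compl₂_apply, LinearMap.comp_apply, hS,
      Submodule.subtype_apply]
    have h := hA (hmem u) (b (x : V)) (b (y : V))
    rw [hQb, hQb, iso (hmem y) (hmem u), iso (hmem x) (hmem u), bl (x : V) (u : V),
      bl (y : V) (u : V)] at h
    linear_combination h)
  -- the block identities in `V`-terms
  have B1 : ∀ {m n : V}, a m = i • m → a n = i • n → c m n = μ₁ * Q m (b n) := fun {m n} hm hn => by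
    have := hμ₁ ⟨m, memM.mpr hm⟩ ⟨n, memM.mpr hn⟩
    simpa [ωM_apply, hS] using this
  have B2 : ∀ {m n : V}, a m = i • m → a n = i • n → c m (b n) = μ₂ * Q m (b n) :=
    fun {m n} hm hn => by
    have := hμ₂ ⟨m, memM.mpr hm⟩ ⟨n, memM.mpr hn⟩
    simpa [ωM_apply, hS] using this
  have B3 : ∀ {m n : V}, a m = i • m → a n = i • n → c (b m) n = μ₃ * Q m (b n) :=
    fun {m n} hm hn => by
    have := hμ₃ ⟨m, memM.mpr hm⟩ ⟨n, memM.mpr hn⟩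
    simpa [ωM_apply, hS] using this
  have B4 : ∀ {m n : V}, a m = i • m → a n = i • n → c (b m) (b n) = μ₄ * Q m (b n) :=
    fun {m n} hm hn => by
    have := hμ₄ ⟨m, memM.mpr hm⟩ ⟨n, memM.mpr hn⟩
    simpa [ωM_apply, hS] using this
  -- (E) assemble: every vector is `m + b m'` with `m m' ∈ M`
  have decomp : ∀ x : V, ∃ m m' : V, a m = i • m ∧ a m' = i • m' ∧ x = m + b m' := by
    intro x
    refine ⟨(1 / 2 : K) • (x - i • a x), (-(1 / 2 : K)) • b (x + i • a x), ?_, ?_, ?_⟩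
    · simp only [map_smul, map_sub, haa, smul_neg]
      linear_combination (norm := module) ((1 / 2 : K) * hi) • a x
    · simp only [map_smul, map_neg, map_add, hab, haa, smul_neg]
      linear_combination (norm := module) ((1 / 2 : K) * hi) • b (a x)
    · simp only [map_smul, map_add, hbb, map_smul, smul_add, smul_neg]
      module
  refine ⟨(μ₂ - μ₃) / 2, i * (μ₂ + μ₃) / 2, (μ₁ + μ₄) / 2, i * (μ₁ - μ₄) / 2, fun x y => ?_⟩
  obtain ⟨m, m', hm, hm', rfl⟩ := decomp x
  obtain ⟨n, n', hn, hn', rfl⟩ := decomp y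
  have e1 := B1 hm hn
  have e2 := B2 hm hn'
  have e3 := B3 hm' hn
  have e4 := B4 hm' hn'
  have hbn : a (b n) = (-i) • b n := b_eigen hab hn
  have hbn' : a (b n') = (-i) • b n' := b_eigen hab hn'
  have z1 : Q m n = 0 := iso hm hn
  have z2 : Q m' n' = 0 := iso hm' hn'
  have z3 : Q m' n = 0 := iso hm' hn
  have z4 : Q m n' = 0 := iso hm hn'
  simp only [map_add, map_smul, map_neg, LinearMap.add_apply, smul_eq_mul, hn, hbn', hbb, hab, hn',
    hQb, bl m' n, bl m' n', z1, z2, z3, z4, e1, e2, e3, e4, neg_neg, mul_neg, add_zero, zero_add]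
  linear_combination ((μ₂ + μ₃) / 2 * (Q m (b n') + Q m' (b n)) -
    (μ₁ - μ₄) / 2 * (Q m' (b n') - Q m (b n))) * hi

end Summit.HodgeConjecture.HodgeConjecture.Theorems.Q8CommutatorDegreeTwoCoreCayley
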